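import Summits.QuantumFields.BalabanUV.Beta.FP.TorusCompositeRowsLattice
import Summits.QuantumFields.BalabanUV.Beta.RelInvComposite
import Summits.QuantumFields.BalabanUV.Beta.CompositeCorrectorBordered

/-!
# `BalabanUV.Beta.FP.TorusCompositeRowsChart` — road «FP» for binder row D1, ROUTE T: **THE `hQ` BLOCK IDENTIFICATIONS AT THE (C1) COMPOSITE ONE-SHOT CHART OF
# RECORD `bhKcomp r Lc m` (K-U3d's re-linearised bordered operator `Φ̂ᵀ∘bhK(Lc^m)∘Φ̂`, an2 W-3 (a) l.53579 ∕ OFFER-2 l.53825), UNIT DISPLAYED** —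
# `(∏_{i<n+1} stepScale d Lc (lev (i+1))) • (perF T (bhKcomp r Lc (n+1))).submatrix fF (ff) = compRows Lc M lev rs (n+1)` (system F) and
# `(∏_{i<n+2} stepScale d Lc (lev i)) • (perF T (bhKcomp r Lc (n+2))).submatrix fN (ff) = Q₂₀ * compRows Lc M lev rs (n+1)` (system N, `𝔔₀`)

WHY.  leaf-05 g37's OFFER `TowerLawFullIndexCharts` (c635a36c6318ccc5) displays per one-shot system exactly the slot presentation and TWO block identifications,
`hH` and `hQ : (perF T 𝕄_X).submatrix f_X (ff) = Q₁₀ ∕ 𝔔₀` (:210 ∕ :183); an2's OFFER-2 `CompositeOneShotChart` supplies the seven chart letters of `𝕄_X := bhKcomp r Lc ·`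
and says (A-3) «`hQ` carries the GLOBAL UNIT `∏_k stepScale d Lc (lev k)` of `Q₂₀·compRows` against `bhKcomp`'s bare `compLinAvgAt` border».  THIS FILE is that `hQ`
identification AT `bhKcomp`, HONESTLY — with the unit on the chart side (the bare border has scale `1`): ONE term each of `TorusCompositeRowsLattice.smul_perF_submatrix_eq_smul_compRows`
∕ `…_topStep_mul_compRows` at `s = 1`, fed `CompositeCorrectorBordered.trK_phiK_bhK_phiK_inr_inl` (the border of `bhKcomp r L m` IS `[proj (L^m) x = 0]·compLinAvgAt r L m δ_{(β,w)} κ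
(x∕L^m)`) and leaf-06's `bigRatio_eq_pow` (`bigRatio Lc n = Lc^(n+1)`).  So `hQF ∕ hQN` ON THE NOSE hold for the unit-conjugated chart (the OWNER's #40a `KktUnitConjugation` pattern ∕
`KernelPeriodisationFib.perF_unitK`) or for a scaled border from the tables — the row's ∕ the OWNER's choice; the dictionary `hr` between the corrector roots `r` (bottom-up)
and the tower's `rs` (top-down) stays DISPLAYED (the tables' business, an2 A-3).

WHAT.  `bhKcomp_inr_inl_bigRatio` (the border in the tower's scale spelling), **`smul_perF_bhKcomp_submatrix_eq_compRows`** (F), **`smul_perF_bhKcomp_submatrix_eq_topStep_mul_compRows`** (N).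
[folklore] BY NAME; no `def`, no `def … : Prop`, nothing cited, 0 sorry.  Nothing of K-U3d restated (its objects consumed by name); nothing of the dictionary ∕ Bałaban's
non-linear averages asserted beyond their typed linearisations; the `hH` identification, the seven letters, (C1)'s TABLES, the legs, (P2‴), the END: NOT HERE.

HONEST DEPENDENCY (page 1, mandatory): continuum YM on T⁴ ⇐ BetaPertH ∧ nine spine estimates (0/9 proved); BetaPertH ⇐ (D1) ∧ (D4) ∧ CAP+tail;
G-an2-4 gates asym, D1 and NE2/3/4.  HONEST FRAMING (cell contract, verbatim): «discharging `BetaPertH` makes Bałaban's UV stability UNCONDITIONAL —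
a real constructive-QFT result; it is NOT the continuum limit and NOT the Clay problem.»  ABSOLUTE RULE (cell charter, verbatim): «No internally-minted
statement may enter as a cited fact. Every hypothesis is either kernel-proved in this package or a verbatim quotation of a PUBLISHED theorem with page
reference. The manuscript(s) under audit are NOT citable for their own disputed steps — they are the thing under adjudication; programme-internal
(2001/route/tribunal) claims are never citable.»  0 estimates; 0∕4 row-D1 binders (hW, hR, D1Tel, D1Rep); NOT (T-ID), NOT (C1), NOT SDF, NOT D1,
NOT BetaPertH, NOT continuum, NOT Clay.  D1 formalisation swarm LEAF PROVER 02 (b2b-balaban-beta-d1-formalise-leaf-02 gen 27), 2026-08-23.  No existing file touched.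
-/

noncomputable section

open scoped BigOperators Matrix

namespace Summit.QuantumFields.BalabanUV.Beta.FP.TorusCompositeRowsChart

open Matrix Finset
open Literature.Probability.LatticeModels (Torus.proj)
open Literature.MathematicalPhysics.QuantumFieldTheory
open Literature.MathematicalPhysics.QuantumFieldTheory.Balaban1983to89
open Literature.MathematicalPhysics.QuantumFieldTheory.Balaban1983to89.Beta
open B6Lemma24Torus (pbox)
open AffineAveraging (Site Form1 box toSite)
open ExpKernelCalculus (MKer)
open KKTFluctuationKernel (delta1)
open LatticeForm (quo)
open OneStepResolventKernel (Fib)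
open Summit.QuantumFields.BalabanUV.Beta.BorderedHessian (stepScale bhKStepAt)
open Summit.QuantumFields.BalabanUV.Beta.FP.KernelPeriodisationFib (Idx perF)
open Summit.QuantumFields.BalabanUV.Beta.FP.TorusCompositeObjects (towerTorus compRows bigRatio bigRatio_eq_pow)
open Summit.QuantumFields.BalabanUV.Beta.CompositeAveragingCoarseExact (compLinAvgAt)
open Summit.QuantumFields.BalabanUV.Beta.RelInvComposite (bhKcomp bhKcomp_eq)
open Summit.QuantumFields.BalabanUV.Beta.CompositeCorrectorBordered (trK_phiK_bhK_phiK_inr_inl)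
open Summit.QuantumFields.BalabanUV.Beta.FP.TorusCompositeRowsLattice (smul_perF_submatrix_eq_smul_compRows smul_perF_submatrix_eq_smul_topStep_mul_compRows)

variable {d : ℕ} (Lc : ℕ) [NeZero Lc]

/-- [folklore] the multiplier–field block of the chart of record `bhKcomp r Lc (n+1)` in the tower's scale spelling `bigRatio Lc n` (= `Lc^(n+1)`, leaf-06), with the
(bare) unit `1` displayed in `TorusCompositeRowsLattice`'s hypothesis shape. -/
theorem bhKcomp_inr_inl_bigRatio (r : ℕ → (Fin (d + 1) → ℕ)) (n : ℕ) (x w : Fin (d + 1) → ℤ) (κ β : Fin (d + 1)) :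
    bhKcomp r Lc (n + 1) x w (Sum.inr κ) (Sum.inl β)
      = if Torus.proj (bigRatio Lc n) x = 0 then (1 : ℝ) * compLinAvgAt r Lc (n + 1) (delta1 β w) κ (quo (bigRatio Lc n) x) else 0 := by
  rw [bhKcomp_eq, trK_phiK_bhK_phiK_inr_inl r (n + 1) (Nat.pos_of_ne_zero (NeZero.ne Lc)), one_mul, bigRatio_eq_pow]

/-- [folklore] **SYSTEM F — THE `hQ` IDENTIFICATION AT THE CHART OF RECORD, UNIT DISPLAYED**: for the tower of depth `n+1` below `M` (levels `lev`, in-block roots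
`rs` from the top), corrector roots `r` from the bottom with `r i = rs (j+1)` for `i + j = n`, and ANY slot presentation `fF` reading `a ↦ (bigRatio Lc n • a.1, inr a.2)`:
`(∏_{i<n+1} stepScale d Lc (lev (i+1))) • (perF T (bhKcomp r Lc (n+1))).submatrix fF (ff) = compRows Lc M lev rs (n+1)`, `T = towerTorus Lc M (n+1)`. -/
theorem smul_perF_bhKcomp_submatrix_eq_compRows (n : ℕ) (M : Fin (d + 1) → ℕ) [∀ μ, NeZero (M μ)] (lev : ℕ → ℕ)
    (rs : ℕ → (Fin (d + 1) → ℕ)) (hrs : ∀ k, rs k ∈ box (d + 1) Lc) (r : ℕ → (Fin (d + 1) → ℕ))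
    (hr : ∀ i j : ℕ, i + j = n → r i = rs (j + 1))
    (fF : ↥(pbox M) × Fin (d + 1) → Idx (towerTorus Lc M (n + 1)) (Fib d))
    (hfF₁ : ∀ a, ((fF a).1 : Fin (d + 1) → ℤ) = (bigRatio Lc n : ℤ) • (a.1 : Fin (d + 1) → ℤ)) (hfF₂ : ∀ a, (fF a).2 = Sum.inr a.2) :
    (∏ i ∈ Finset.range (n + 1), stepScale d Lc (lev (i + 1))) •
        (perF (towerTorus Lc M (n + 1)) (bhKcomp r Lc (n + 1))).submatrix fF
          (fun b : ↥(pbox (towerTorus Lc M (n + 1))) × Fin (d + 1) => ((b.1, Sum.inl b.2) : Idx (towerTorus Lc M (n + 1)) (Fib d)))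
      = compRows Lc M lev rs (n + 1) := by
  have h := smul_perF_submatrix_eq_smul_compRows Lc n M lev rs hrs r hr 1 (K := bhKcomp r Lc (n + 1))
    (fun x w κ β => bhKcomp_inr_inl_bigRatio Lc r n x w κ β) fF hfF₁ hfF₂
  rwa [one_smul] at h

/-- [folklore] **SYSTEM N (`𝔔₀ = Q₂₀ * Q₁₀`) — THE `hQ` IDENTIFICATION AT THE CHART OF RECORD OF DEPTH `n+2`, UNIT DISPLAYED**: with #21's slot presentation
`a ↦ (pμ′ a, inr (mμ′ a))` of the `M`-slots (`proj Lc (pμ′ a) = 0`), `fN` reading `a ↦ (bigRatio Lc n • pμ′ a, inr (mμ′ a))`, corrector roots `r i = rs j` for `i + j = n+1`: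
`(∏_{i<n+2} stepScale d Lc (lev i)) • (perF T (bhKcomp r Lc (n+2))).submatrix fN (ff) = Q₂₀ * compRows Lc M lev rs (n+1)` with `Q₂₀` in #21's `hQ₂₀` spelling. -/
theorem smul_perF_bhKcomp_submatrix_eq_topStep_mul_compRows (n : ℕ) (M : Fin (d + 1) → ℕ) [∀ μ, NeZero (M μ)] (lev : ℕ → ℕ)
    (rs : ℕ → (Fin (d + 1) → ℕ)) (hrs : ∀ k, rs k ∈ box (d + 1) Lc) (r : ℕ → (Fin (d + 1) → ℕ))
    (hr : ∀ i j : ℕ, i + j = n + 1 → r i = rs j) {κ' : Type*} [Fintype κ'] (pμ : κ' → ↥(pbox M)) (mμ : κ' → Fin (d + 1))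
    (hpμ : ∀ a, Torus.proj Lc ((pμ a : ↥(pbox M)) : Fin (d + 1) → ℤ) = 0)
    (fN : κ' → Idx (towerTorus Lc M (n + 1)) (Fib d))
    (hfN₁ : ∀ a, ((fN a).1 : Fin (d + 1) → ℤ) = (bigRatio Lc n : ℤ) • ((pμ a : ↥(pbox M)) : Fin (d + 1) → ℤ)) (hfN₂ : ∀ a, (fN a).2 = Sum.inr (mμ a)) :
    (∏ i ∈ Finset.range (n + 2), stepScale d Lc (lev i)) •
        (perF (towerTorus Lc M (n + 1)) (bhKcomp r Lc (n + 2))).submatrix fN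
          (fun b : ↥(pbox (towerTorus Lc M (n + 1))) × Fin (d + 1) => ((b.1, Sum.inl b.2) : Idx (towerTorus Lc M (n + 1)) (Fib d)))
      = (perF M (bhKStepAt d (toSite (rs 0)) Lc (lev 0))).submatrix (fun a : κ' => ((pμ a, Sum.inr (mμ a)) : Idx M (Fib d)))
          (fun b : ↥(pbox M) × Fin (d + 1) => ((b.1, Sum.inl b.2) : Idx M (Fib d))) * compRows Lc M lev rs (n + 1) := by
  have h := smul_perF_submatrix_eq_smul_topStep_mul_compRows Lc n M lev rs hrs r hr pμ mμ hpμ 1 (K := bhKcomp r Lc (n + 2))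
    (fun x w κ β => bhKcomp_inr_inl_bigRatio Lc r (n + 1) x w κ β) fN hfN₁ hfN₂
  rwa [one_smul] at h

end Summit.QuantumFields.BalabanUV.Beta.FP.TorusCompositeRowsChart

end
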